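import Literature.NumberTheory.EllipticCurves.Rank1Residual.AnomalousDictionaryProofs
import Literature.NumberTheory.EllipticCurves.AnomalousOfRationalTorsionProofs
import HarnessLib

/-!
# Class X10b (N2): `a_p mod p` is an invariant of the mod-`p` Galois module at a good ORDINARY odd
# prime — congruent curves are anomalous together (cell `b2b-bsdres`, unit `b2b-bsdres-x10` = N2
# class lead, gen 24; the class's λ-subpartition, `class-closure/N2/LAMBDA-SUBPARTITION-x10g24.md` §4)

HONEST FRAMING (run/shared/lean/b2b/bsd-rank1-residual/, verbatim in every file): the goal of the
cell is to DELETE the COMBINATION-SHAPED residual classes of the Birch–Swinnerton-Dyer formula for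
ALL analytic-rank `≤ 1` elliptic curves over `ℚ` — "full BSD formula for every rank `≤ 1` curve in
class `C`" assembled STRICTLY from published theorems — so that the rank-`≤ 1` remainder becomes
exactly the CONSTRUCTION-SHAPED classes, which are TYPED (missing-input `Prop`s), NOT attempted.
This is not "finishing BSD". TOOL theorems only (our own composition, hence `Summits/`); no definition,
no named fact; nothing booked; no mark moves.

## What and why

Kraus–Oesterlé 1992 Prop. 3 (tree: `KrausOesterle1992.frobeniusTrace_congr_of_addEquiv_geomTorsion`)
gives `a_ℓ(E) ≡ a_ℓ(A) (mod p)` at the good primes `ℓ ≠ p` of two curves with `Γ_ℚ`-isomorphic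
`p`-torsion. THIS FILE proves the congruence AT `ℓ = p` when both curves are good ORDINARY at the odd
prime `p`: `a_p(E) ≡ a_p(A) (mod p)` (`dvd_frobeniusTrace_sub_of_addEquiv_geomTorsion_self`). Proof
(Serre 1972 §1.11, with the tree's `AnomalousDictionaryProofs` toolkit): the kernel `X ⊂ E[p]` of
reduction at the place over `p` is the subgroup GENERATED by the inertia coboundaries `τ•P − P`
(`ker_reduction_eq_closure_inertia_moves`: they lie in `X` since inertia is trivial on `E[p]/X`, and one
of them is non-zero in the prime-order group `X`), a description preserved by any `Γ_ℚ`-equivariant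
`e : E[p] ≃ A[p]`; an arithmetic Frobenius acts on `E[p]/X` by `a_p(E)` and on `A[p]/X'` by `a_p(A)`,
so `(a_p(E) − a_p(A))·A[p] ⊆ X'`, impossible for a `p`-adic unit `a_p(E) − a_p(A)` (`#X' = p < p²`).
Consequence for the cell (`anomalous_iff_of_torsionIso`): "anomalous at `p`" (`a_p ≡ 1`) is constant
on mod-`p` congruence classes of good ordinary curves — no ANOMALOUS N2 cell has a partner with trivial
`3`-primary arithmetic, so the unit / trivial-partner roads of `X10/UnitRoad.lean` never reach the 138
anomalous N2 cells (X10-AUDIT §30). Axioms standard.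

References: J.-P. Serre, Invent. Math. 15 (1972) §1.11 Prop. 11 and Cor. [Serre1972]; A. Kraus,
J. Oesterlé, Math. Ann. 293 (1992) Prop. 3 [KrausOesterle1992]; B. Mazur, Invent. Math. 18 (1972) §1
(anomalous primes) [Mazur1972].
-/

set_option autoImplicit false

noncomputable section

open scoped Classical NumberField Pointwise

open WeierstrassCurve Literature.NumberTheory.EllipticCurves Literature.NumberTheory.GaloisRepresentations
  Field IsDedekindDomain NumberField Rat.HeightOneSpectrum
  Literature.NumberTheory.EllipticCurves.Rank1Residual

namespace Summit.BirchSwinnertonDyer.Rank1Residual.X10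

variable {W G : WeierstrassCurve ℚ} [W.IsElliptic] [W.IsGloballyMinimal] [G.IsElliptic]
  [G.IsGloballyMinimal] {p : ℕ} [Fact p.Prime]

/-- **The kernel of reduction on `E[p]` is generated by the inertia coboundaries.** `W/ℚ` globally
minimal elliptic, `p` odd, `p ∤ Δ_W`, `p ∤ a_p` (good ordinary), `𝔓` the place's prime above `p` with
inertia group `I_𝔓 ≤ Γ_ℚ`, `X = ker (red | E[p])`. Then `X` is the subgroup generated by
`{τ•P − P : τ ∈ I_𝔓, P ∈ E[p]}`: inertia is trivial on `E[p]/X`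
(`smul_sub_self_mem_ker_of_mem_inertia`), and some coboundary is a non-zero element of the group `X`
of prime order `p` (`exists_mem_inertia_smul_ne_of_mem_ker`). [cite: Serre1972, §1.11 Prop. 11 and Cor.] -/
theorem ker_reduction_eq_closure_inertia_moves (hp2 : p ≠ 2)
    (hΔ : ¬ (p : ℤ) ∣ minimalDiscriminantInt W)
    (hgood : W.HasGoodReductionAtPrime p) (hord : ¬ (p : ℤ) ∣ W.frobeniusTrace p)
    {𝔓 : Ideal (absIntegers (𝓞 ℚ) ℚ)}
    (hmem : ∀ x : absIntegers (𝓞 ℚ) ℚ, x ∈ 𝔓 ↔ (x : AlgebraicClosure ℚ) ∈ (placeOver p).nonunits)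
    {v : HeightOneSpectrum (𝓞 ℚ)} (hv : (primesEquiv v : ℕ) = p) (h𝔓 : 𝔓 ∈ v.primesAbove) :
    ((geomReduction hΔ).comp (geomTorsion W (p : ℤ)).subtype).ker =
      AddSubgroup.closure {x : geomTorsion W (p : ℤ) |
        ∃ τ ∈ 𝔓.inertia (absoluteGaloisGroup ℚ), ∃ P : geomTorsion W (p : ℤ), x = τ • P - P} := by
  have hp : p.Prime := Fact.out
  set X := ((geomReduction hΔ).comp (geomTorsion W (p : ℤ)).subtype).ker with hXdef
  set M := AddSubgroup.closure {x : geomTorsion W (p : ℤ) |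
        ∃ τ ∈ 𝔓.inertia (absoluteGaloisGroup ℚ), ∃ P : geomTorsion W (p : ℤ), x = τ • P - P} with hMdef
  -- the coboundaries lie in `X`
  have hMX : M ≤ X := by
    rw [hMdef, AddSubgroup.closure_le]
    rintro x ⟨τ, hτ, P, rfl⟩
    exact smul_sub_self_mem_ker_of_mem_inertia hΔ hmem hτ P
  -- `#X = p` and a non-zero coboundary
  obtain ⟨hXcard, τ, hτ, Q, -, hτQ⟩ :=
    exists_mem_inertia_smul_ne_of_mem_ker hp2 hΔ hgood hord hmem hv h𝔓
  have hne : τ • Q - Q ≠ 0 := fun h ↦ hτQ (sub_eq_zero.mp h)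
  have hgen : τ • Q - Q ∈ M := AddSubgroup.subset_closure ⟨τ, hτ, Q, rfl⟩
  haveI hXfin : Finite X := Nat.finite_of_card_ne_zero (by rw [hXcard]; exact hp.ne_zero)
  haveI : Finite M := Finite.of_injective _ (AddSubgroup.inclusion_injective hMX)
  -- `#M ∣ p`, `M ≠ ⊥`, hence `#M = p` and `M = X`
  have hdvd : Nat.card M ∣ p := by
    have h := AddSubgroup.card_dvd_of_le hMX
    rwa [hXcard] at h
  rcases (Nat.dvd_prime hp).mp hdvd with h1 | h2
  · exfalso
    have hbot : M = ⊥ := AddSubgroup.eq_bot_of_card_eq _ h1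
    rw [hbot, AddSubgroup.mem_bot] at hgen
    exact hne hgen
  · exact (AddSubgroup.eq_of_le_of_card_ge hMX (by rw [hXcard, h2])).symm

/-- A `Γ_ℚ`-equivariant additive isomorphism `e : E[p] ≃ A[p]` maps the kernel of reduction of `E`
at the place over `p` onto that of `A` (both curves good ordinary at the odd prime `p`): both kernels
are generated by the inertia coboundaries, which `e` matches. [cite: Serre1972, §1.11 Prop. 11 and Cor.] -/
theorem map_ker_reduction_eq_of_addEquiv_geomTorsion (hp2 : p ≠ 2)
    (hΔW : ¬ (p : ℤ) ∣ minimalDiscriminantInt W) (hΔG : ¬ (p : ℤ) ∣ minimalDiscriminantInt G)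
    (hgoodW : W.HasGoodReductionAtPrime p) (hordW : ¬ (p : ℤ) ∣ W.frobeniusTrace p)
    (hgoodG : G.HasGoodReductionAtPrime p) (hordG : ¬ (p : ℤ) ∣ G.frobeniusTrace p)
    {𝔓 : Ideal (absIntegers (𝓞 ℚ) ℚ)}
    (hmem : ∀ x : absIntegers (𝓞 ℚ) ℚ, x ∈ 𝔓 ↔ (x : AlgebraicClosure ℚ) ∈ (placeOver p).nonunits)
    {v : HeightOneSpectrum (𝓞 ℚ)} (hv : (primesEquiv v : ℕ) = p) (h𝔓 : 𝔓 ∈ v.primesAbove)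
    (e : geomTorsion W (p : ℤ) ≃+ geomTorsion G (p : ℤ))
    (he : ∀ (σ : absoluteGaloisGroup ℚ) (P : geomTorsion W (p : ℤ)), e (σ • P) = σ • e P) :
    (((geomReduction hΔW).comp (geomTorsion W (p : ℤ)).subtype).ker).map (e : geomTorsion W (p : ℤ) →+ geomTorsion G (p : ℤ)) =
      ((geomReduction hΔG).comp (geomTorsion G (p : ℤ)).subtype).ker := by
  rw [ker_reduction_eq_closure_inertia_moves hp2 hΔW hgoodW hordW hmem hv h𝔓,
    ker_reduction_eq_closure_inertia_moves hp2 hΔG hgoodG hordG hmem hv h𝔓,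
    AddMonoidHom.map_closure]
  congr 1
  ext x
  constructor
  · rintro ⟨y, ⟨τ, hτ, P, rfl⟩, rfl⟩
    exact ⟨τ, hτ, e P, by simp [map_sub, he]⟩
  · rintro ⟨τ, hτ, Q, rfl⟩
    refine ⟨τ • e.symm Q - e.symm Q, ⟨τ, hτ, e.symm Q, rfl⟩, ?_⟩
    simp [map_sub, he]

/-- **`a_p(E) ≡ a_p(A) (mod p)` for congruent good ORDINARY curves at an odd prime `p`.** Let `W, G /ℚ`
be globally minimal elliptic curves, `p` odd, both with good ordinary reduction at `p` (`p ∤ Δ`,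
`p ∤ a_p`), and `e : W[p] ≃+ G[p]` a `Γ_ℚ`-equivariant additive isomorphism. Then
`p ∣ a_p(W) − a_p(G)`. An arithmetic Frobenius `σ` at the place's prime acts on `E[p]/X` by `a_p`
(`smul_sub_frobeniusTrace_smul_mem_ker`); transporting along `e` (which matches the kernels of
reduction, `map_ker_reduction_eq_of_addEquiv_geomTorsion`) gives `(a_p(W) − a_p(G))·A[p] ⊆ X_A`, and
`#X_A = p < p² = #A[p]` forces `p ∣ a_p(W) − a_p(G)`. The `ℓ = p` companion of Kraus–Oesterlé's
`ℓ ≠ p` trace congruence. [cite: Serre1972, §1.11 (1), Prop. 11 and Cor.] [cite: KrausOesterle1992, §3 Prop. 3] -/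
theorem dvd_frobeniusTrace_sub_of_addEquiv_geomTorsion_self (hp2 : p ≠ 2)
    (hgoodW : W.HasGoodReductionAtPrime p) (hordW : ¬ (p : ℤ) ∣ W.frobeniusTrace p)
    (hgoodG : G.HasGoodReductionAtPrime p) (hordG : ¬ (p : ℤ) ∣ G.frobeniusTrace p)
    (e : geomTorsion W (p : ℤ) ≃+ geomTorsion G (p : ℤ))
    (he : ∀ (σ : absoluteGaloisGroup ℚ) (P : geomTorsion W (p : ℤ)), e (σ • P) = σ • e P) :
    (p : ℤ) ∣ W.frobeniusTrace p - G.frobeniusTrace p := by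
  have hp : p.Prime := Fact.out
  have hΔW : ¬ (p : ℤ) ∣ minimalDiscriminantInt W :=
    W.not_dvd_minimalDiscriminantInt_of_hasGoodReductionAtPrime' p hgoodW
  have hΔG : ¬ (p : ℤ) ∣ minimalDiscriminantInt G :=
    G.not_dvd_minimalDiscriminantInt_of_hasGoodReductionAtPrime' p hgoodG
  obtain ⟨v, 𝔓, σ, hv, hmem, h𝔓, hσ⟩ := exists_isArithFrobAt_placeOver p
  set XG := ((geomReduction hΔG).comp (geomTorsion G (p : ℤ)).subtype).ker with hXGdef
  have hXGcard : Nat.card XG = p :=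
    (exists_mem_inertia_smul_ne_of_mem_ker hp2 hΔG hgoodG hordG hmem hv h𝔓).1
  have hmap := map_ker_reduction_eq_of_addEquiv_geomTorsion hp2 hΔW hΔG hgoodW hordW hgoodG hordG
    hmem hv h𝔓 e he
  set d : ℤ := W.frobeniusTrace p - G.frobeniusTrace p with hd
  -- `d • Q ∈ X_G` for every `Q ∈ G[p]`
  have hdQ : ∀ Q : geomTorsion G (p : ℤ), d • Q ∈ XG := by
    intro Q
    set P := e.symm Q with hP
    have hQ : e P = Q := e.apply_symm_apply Q
    have h1 : σ • P - (W.frobeniusTrace p) • P ∈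
        ((geomReduction hΔW).comp (geomTorsion W (p : ℤ)).subtype).ker :=
      smul_sub_frobeniusTrace_smul_mem_ker hΔW hmem hv h𝔓 hσ P
    have h1' : σ • Q - (W.frobeniusTrace p) • Q ∈ XG := by
      rw [hXGdef, ← hmap]
      refine ⟨σ • P - (W.frobeniusTrace p) • P, h1, ?_⟩
      rw [AddMonoidHom.coe_coe, map_sub, map_zsmul, he, hQ]
    have h2 : σ • Q - (G.frobeniusTrace p) • Q ∈ XG :=
      smul_sub_frobeniusTrace_smul_mem_ker hΔG hmem hv h𝔓 hσ Q
    have h3 := XG.sub_mem h2 h1'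
    have h4 : σ • Q - (G.frobeniusTrace p) • Q - (σ • Q - (W.frobeniusTrace p) • Q) = d • Q := by
      rw [hd, sub_smul]; abel
    rwa [h4] at h3
  -- if `p ∤ d`, every `Q` lies in `X_G`
  by_contra hnd
  letI : Module (ZMod p) (geomTorsion G (p : ℤ)) := AddSubgroup.torsionBy.zmodModule
  have hd0 : ((d : ℤ) : ZMod p) ≠ 0 := by
    rwa [Ne, ZMod.intCast_zmod_eq_zero_iff_dvd]
  have htop : ∀ Q : geomTorsion G (p : ℤ), Q ∈ XG := by
    intro Q
    have h1 : ((d : ℤ) : ZMod p) • Q ∈ XG := by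
      rw [Int.cast_smul_eq_zsmul]; exact hdQ Q
    have h2 : Q = ((d : ℤ) : ZMod p)⁻¹ • (((d : ℤ) : ZMod p) • Q) := by
      rw [smul_smul, inv_mul_cancel₀ hd0, one_smul]
    rw [h2, ← ZMod.natCast_zmod_val (((d : ℤ) : ZMod p)⁻¹), Nat.cast_smul_eq_nsmul]
    exact XG.nsmul_mem h1 _
  have hXtop : XG = ⊤ := by
    ext Q; exact ⟨fun _ ↦ trivial, fun _ ↦ htop Q⟩
  have hcard : Nat.card XG = p ^ 2 := by
    rw [hXtop, AddSubgroup.card_top, Literature.NumberTheory.EllipticCurves.natCard_geomTorsion G p]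
  rw [hXGcard] at hcard
  have : p ^ 1 = p ^ 2 := by rw [pow_one]; exact hcard
  exact absurd (Nat.pow_right_injective hp.two_le this) (by norm_num)

/-- **"Anomalous" is a congruence invariant** (the cell's spelling): for globally minimal elliptic
`W, G /ℚ` good ORDINARY at the odd prime `p` with `Γ_ℚ`-isomorphic `p`-torsion
(`hC1 : ∃ e : G[p] ≃+ W[p]` equivariant — certificate C1 of the cell),
`p ∣ a_p(W) − 1 ↔ p ∣ a_p(G) − 1`. So an anomalous N2 cell has only anomalous partners, and the
trivial-arithmetic roads of `X10/UnitRoad.lean` (which need `p ∤ #Ẽ(𝔽_p)`, i.e. `a_p ≢ 1`) cannot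
reach it. [cite: Serre1972, §1.11 (1), Prop. 11 and Cor.] [cite: Mazur1972, §1 (anomalous primes)] -/
theorem dvd_frobeniusTrace_sub_one_iff_of_torsionIso (hp2 : p ≠ 2)
    (hgoodW : W.HasGoodReductionAtPrime p) (hordW : ¬ (p : ℤ) ∣ W.frobeniusTrace p)
    (hgoodG : G.HasGoodReductionAtPrime p) (hordG : ¬ (p : ℤ) ∣ G.frobeniusTrace p)
    (hC1 : ∃ e : geomTorsion G (p : ℤ) ≃+ geomTorsion W (p : ℤ),
      ∀ (σ : absoluteGaloisGroup ℚ) (P : geomTorsion G (p : ℤ)), e (σ • P) = σ • e P) :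
    (p : ℤ) ∣ W.frobeniusTrace p - 1 ↔ (p : ℤ) ∣ G.frobeniusTrace p - 1 := by
  obtain ⟨e, he⟩ := hC1
  have h := dvd_frobeniusTrace_sub_of_addEquiv_geomTorsion_self hp2 hgoodG hordG hgoodW hordW e he
  constructor
  · intro hW
    have : G.frobeniusTrace p - 1 = (G.frobeniusTrace p - W.frobeniusTrace p) + (W.frobeniusTrace p - 1) := by
      ring
    rw [this]; exact dvd_add h hW
  · intro hG
    have : W.frobeniusTrace p - 1 = (W.frobeniusTrace p - 1 - (G.frobeniusTrace p - 1)) + (G.frobeniusTrace p - 1) := by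
      ring
    rw [this]
    refine dvd_add ?_ hG
    have h' : W.frobeniusTrace p - 1 - (G.frobeniusTrace p - 1) = -(G.frobeniusTrace p - W.frobeniusTrace p) := by
      ring
    rw [h']; exact (dvd_neg).mpr h

/-- **Non-anomalous reduction point counts agree across C1**: with `#Ẽ(𝔽_p) = p + 1 − a_p`
(`reductionPointCount`), for congruent good ordinary curves at the odd prime `p`,
`p ∣ #W̃(𝔽_p) ↔ p ∣ #G̃(𝔽_p)` — the hypothesis `hna` of the unit road
(`Rank1Residual.mazurMainConjecture_with_mu_zero_of_trivialArithmetic_odd`) is constant on congruence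
classes. [cite: Serre1972, §1.11 (1), Prop. 11 and Cor.] [cite: Mazur1972, §1 (anomalous primes)] -/
theorem dvd_reductionPointCount_iff_of_torsionIso (hp2 : p ≠ 2)
    (hgoodW : W.HasGoodReductionAtPrime p) (hordW : ¬ (p : ℤ) ∣ W.frobeniusTrace p)
    (hgoodG : G.HasGoodReductionAtPrime p) (hordG : ¬ (p : ℤ) ∣ G.frobeniusTrace p)
    (hC1 : ∃ e : geomTorsion G (p : ℤ) ≃+ geomTorsion W (p : ℤ),
      ∀ (σ : absoluteGaloisGroup ℚ) (P : geomTorsion G (p : ℤ)), e (σ • P) = σ • e P) :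
    p ∣ W.reductionPointCount p ↔ p ∣ G.reductionPointCount p := by
  rw [dvd_reductionPointCount_iff_dvd_frobeniusTrace_sub_one W p,
    dvd_reductionPointCount_iff_dvd_frobeniusTrace_sub_one G p]
  exact dvd_frobeniusTrace_sub_one_iff_of_torsionIso hp2 hgoodW hordW hgoodG hordG hC1

end Summit.BirchSwinnertonDyer.Rank1Residual.X10
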